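import Summits.PneNP.PneNP.Theorems.ChebyshevTracialDesignLevelMarginals
import HarnessLib

/-!
# Cell pnp-psdrank, route `ChebyshevTracialDesign`: the operator form of the density budget — for a tight psd rectangle
# the AVERAGE strategies are complementary, `X̄(t) + Ȳ ⪯ I`

Strengthening of `ChebyshevTracialDesignTightDensity` (p428944, `τ_X(t) + τ_Y ≤ 1`) from traces to matrices:
* §1 `0 ⪯ Y ⪯ I ⇒ Y − Y² ⪰ 0` (`sub_mul_self_posSemidef`, via the square root `Y − Y² = √Y (I − Y) √Y`);
* §2 on a TIGHT pair — `0 ⪯ X, Y ⪯ I`, `X Y = 0` — the sum is still a contraction: `X + Y ⪯ I`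
  (`one_sub_add_posSemidef_of_mul_eq_zero`, from the identity `I − X − Y = (I − X − Y)² + (X − X²) + (Y − Y²)`, valid because
  `XY = YX = 0`);
* §3 averaging over the level class `Q_1(t)` with its uniform marginals (`ChebyshevTracialDesignLevelMarginals`, p425886):
  for every tight psd rectangle of every dimension and every cut size `t` with `Q_1(t) ≠ ∅`,
  `X̄(t) + Ȳ ⪯ I` where `X̄(t) = E_{|U|=t} X_U`, `Ȳ = E_M Y_M` (`one_sub_avg_add_avg_posSemidef`). Taking the normalised trace
  gives back `τ_X(t) + τ_Y ≤ 1`; the operator form also bounds the ALIGNMENT of the two average footprints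
  (e.g. `X̄ = Ȳ` forces `X̄ ⪯ I/2`), the quantity planner p1's psd outlook turns on (N2-SpreadStructure.md §SNT (4): the main
  term `tr(X̄Ȳ)` and the missing "alignment lemma"). [cite: BrietDadushPokutta2014, Thm. 6 (§3)] [cite: Rothvoss2017, §2 (PDF p. 6)]
WHAT THIS IS NOT: no alignment lemma; nothing on psd rank. Supports crux stmt-PneNP-19878.
-/

set_option linter.dupNamespace false -- `Summit.PneNP.PneNP.…`: summit = sub-problem (D-0017)

noncomputable section

namespace Summit.PneNP.PneNP.Theorems.ChebyshevTracialDesignTightOperator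

open Finset Matrix Literature.Barriers.PneNP Literature.Combinatorics.Optimization
open Summit.PneNP.PneNP.Theorems.ChebyshevTracialDesignLevelMarginals
open scoped MatrixOrder

variable {n : ℕ}

/-! ### §1 A contraction dominates its square -/

/-- `0 ⪯ Y ⪯ I ⇒ Y − Y² ⪰ 0` (`Y − Y² = √Y (I − Y) √Y`). -/
theorem sub_mul_self_posSemidef {r : ℕ} {Y : Matrix (Fin r) (Fin r) ℝ} (hY : Y.PosSemidef) (h1 : (1 - Y).PosSemidef) :
    (Y - Y * Y).PosSemidef := by
  set S : Matrix (Fin r) (Fin r) ℝ := CFC.sqrt Y with hS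
  have hSpsd : S.PosSemidef := (CFC.sqrt_nonneg Y).posSemidef
  have hSS : S * S = Y := CFC.sqrt_mul_sqrt_self Y hY.nonneg
  have hSH : Sᴴ = S := hSpsd.1
  have hSYS : S * Y * S = Y * Y := by
    rw [← hSS]; simp only [Matrix.mul_assoc]
  have key : S * (1 - Y) * Sᴴ = Y - Y * Y := by
    rw [hSH, Matrix.mul_sub, Matrix.mul_one, Matrix.sub_mul, hSS, hSYS]
  rw [← key]
  exact h1.mul_mul_conjTranspose_same S

/-! ### §2 On a tight pair the sum of the two contractions is a contraction -/

/-- **`X + Y ⪯ I` on a tight pair**: if `0 ⪯ X, Y ⪯ I` and `X Y = 0` then `I − (X + Y) ⪰ 0`, by the identity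
`I − X − Y = (I − X − Y)ᴴ(I − X − Y) + (X − X²) + (Y − Y²)` (which uses `XY = YX = 0`). -/
theorem one_sub_add_posSemidef_of_mul_eq_zero {r : ℕ} {X Y : Matrix (Fin r) (Fin r) ℝ} (hX : X.PosSemidef)
    (h1X : (1 - X).PosSemidef) (hY : Y.PosSemidef) (h1Y : (1 - Y).PosSemidef) (hXY : X * Y = 0) :
    (1 - (X + Y)).PosSemidef := by
  have hYX : Y * X = 0 := by
    have h := congrArg Matrix.conjTranspose hXY
    rw [conjTranspose_mul, hX.1, hY.1, conjTranspose_zero] at h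
    exact h
  have hH : (1 - (X + Y))ᴴ = 1 - (X + Y) := by
    rw [conjTranspose_sub, conjTranspose_one, conjTranspose_add, hX.1, hY.1]
  have key : 1 - (X + Y) = (1 - (X + Y))ᴴ * (1 - (X + Y)) + (X - X * X) + (Y - Y * Y) := by
    rw [hH]
    simp only [Matrix.mul_sub, Matrix.sub_mul, Matrix.mul_add, Matrix.add_mul, Matrix.mul_one, Matrix.one_mul, hXY, hYX]
    abel
  rw [key]
  exact ((posSemidef_conjTranspose_mul_self _).add (sub_mul_self_posSemidef hX h1X)).add
    (sub_mul_self_posSemidef hY h1Y)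

/-! ### §3 Averaging over `Q_1(t)`: the average strategies of a tight psd rectangle are complementary -/

/-- Matrix-valued row sums over a level class factor through the plain sum (entrywise `sum_Qset_fst`). -/
theorem sum_Qset_fst_matrix {r : ℕ} (t c : ℕ) (X : OddSet n → Matrix (Fin r) (Fin r) ℝ) (U₀ : OddSet n)
    (hU₀ : U₀.1.card = t) :
    ∑ q ∈ Qset n t c, X q.1 =
      ((univ.filter fun M : PMatch n => cc U₀ M = c).card : ℝ) •
        ∑ U ∈ univ.filter (fun U : OddSet n => U.1.card = t), X U := by
  ext i j
  rw [Matrix.sum_apply, Matrix.smul_apply, Matrix.sum_apply, smul_eq_mul]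
  exact sum_Qset_fst t c (fun U => X U i j) U₀ hU₀

/-- Matrix-valued column sums over a level class factor through the plain sum (entrywise `sum_Qset_snd`). -/
theorem sum_Qset_snd_matrix {r : ℕ} (t c : ℕ) (Y : PMatch n → Matrix (Fin r) (Fin r) ℝ) (M₀ : PMatch n) :
    ∑ q ∈ Qset n t c, Y q.2 =
      ((univ.filter fun U : OddSet n => U.1.card = t ∧ cc U M₀ = c).card : ℝ) • ∑ M, Y M := by
  ext i j
  rw [Matrix.sum_apply, Matrix.smul_apply, Matrix.sum_apply, smul_eq_mul]
  exact sum_Qset_snd t c (fun M => Y M i j) M₀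

/-- **Operator density budget of a tight psd rectangle**: for a psd rectangle `(X, Y)` (any dimension) and a cut size `t`
with `Q_1(t) ≠ ∅`, the average strategies `X̄(t) = (1/#{|U|=t}) Σ_{|U|=t} X_U` and `Ȳ = (1/#M) Σ_M Y_M` satisfy
`X̄(t) + Ȳ ⪯ I`. -/
theorem one_sub_avg_add_avg_posSemidef {t r : ℕ} {X : OddSet n → Matrix (Fin r) (Fin r) ℝ}
    {Y : PMatch n → Matrix (Fin r) (Fin r) ℝ} (h : IsPsdRect X Y) (hQ : (Qset n t 1).Nonempty) :
    (1 - (((1 : ℝ) / (univ.filter (fun U : OddSet n => U.1.card = t)).card) •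
              ∑ U ∈ univ.filter (fun U : OddSet n => U.1.card = t), X U +
           ((1 : ℝ) / Fintype.card (PMatch n)) • ∑ M, Y M)).PosSemidef := by
  obtain ⟨q₀, hq₀⟩ := hQ
  have ht : q₀.1.1.card = t := (mem_Qset_iff.1 hq₀).1
  set T : Finset (OddSet n) := univ.filter (fun U : OddSet n => U.1.card = t) with hT
  set ρ : ℕ := (univ.filter fun M : PMatch n => cc q₀.1 M = 1).card with hρ
  set κ : ℕ := (univ.filter fun U : OddSet n => U.1.card = t ∧ cc U q₀.2 = 1).card with hκ
  set A : Matrix (Fin r) (Fin r) ℝ := ∑ U ∈ T, X U with hA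
  set B : Matrix (Fin r) (Fin r) ℝ := ∑ M, Y M with hB
  have hTpos : (0 : ℝ) < T.card := by
    have : q₀.1 ∈ T := by rw [hT, mem_filter]; exact ⟨mem_univ _, ht⟩
    exact_mod_cast card_pos.2 ⟨_, this⟩
  have hPpos : (0 : ℝ) < Fintype.card (PMatch n) := by exact_mod_cast Fintype.card_pos_iff.2 ⟨q₀.2⟩
  have hρpos : (0 : ℝ) < ρ := by
    have : q₀.2 ∈ univ.filter (fun M : PMatch n => cc q₀.1 M = 1) := by
      rw [mem_filter]; exact ⟨mem_univ _, (mem_Qset_iff.1 hq₀).2⟩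
    exact_mod_cast card_pos.2 ⟨_, this⟩
  have hκpos : (0 : ℝ) < κ := by
    have : q₀.1 ∈ univ.filter (fun U : OddSet n => U.1.card = t ∧ cc U q₀.2 = 1) := by
      rw [mem_filter]; exact ⟨mem_univ _, mem_Qset_iff.1 hq₀⟩
    exact_mod_cast card_pos.2 ⟨_, this⟩
  -- the psd sum over `Q_1(t)`
  have hS : (∑ q ∈ Qset n t 1, (1 - (X q.1 + Y q.2))).PosSemidef :=
    posSemidef_sum _ fun q hq => one_sub_add_posSemidef_of_mul_eq_zero (h.1 q.1).1 (h.1 q.1).2 (h.2.1 q.2).1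
      (h.2.1 q.2).2 (h.2.2 q.1 q.2 (mem_Qset_iff.1 hq).2)
  have hSum : ∑ q ∈ Qset n t 1, (1 - (X q.1 + Y q.2)) =
      ((Qset n t 1).card : ℝ) • (1 : Matrix (Fin r) (Fin r) ℝ) - ((ρ : ℝ) • A + (κ : ℝ) • B) := by
    rw [sum_sub_distrib, sum_add_distrib, sum_const, ← Nat.cast_smul_eq_nsmul ℝ, sum_Qset_fst_matrix t 1 X q₀.1 ht,
      sum_Qset_snd_matrix t 1 Y q₀.2]
  -- `|Q_1(t)| = ρ·#T = κ·#M`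
  have hQρ : ((Qset n t 1).card : ℝ) = (ρ : ℝ) * T.card := by
    rw [hρ, hT]; exact card_Qset_eq_rowCount_mul t 1 q₀.1 ht
  have hQκ : ((Qset n t 1).card : ℝ) = (κ : ℝ) * Fintype.card (PMatch n) := by
    rw [hκ]; exact card_Qset_eq_colCount_mul t 1 q₀.2
  have hQpos : (0 : ℝ) < (Qset n t 1).card := by rw [hQρ]; positivity
  -- rescale by `1/|Q_1(t)|`
  have hscaled := (hSum ▸ hS).smul (one_div_nonneg.2 hQpos.le)
  have e1 : (1 : ℝ) / (Qset n t 1).card * (Qset n t 1).card = 1 := by field_simp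
  have e2 : (1 : ℝ) / (Qset n t 1).card * ρ = 1 / T.card := by rw [hQρ]; field_simp
  have e3 : (1 : ℝ) / (Qset n t 1).card * κ = 1 / Fintype.card (PMatch n) := by rw [hQκ]; field_simp
  rw [smul_sub, smul_add, smul_smul, smul_smul, smul_smul, e1, e2, e3, one_smul] at hscaled
  exact hscaled

/-- The `r`-normalised trace of §3 is the scalar density budget `τ_X(t) + τ_Y ≤ 1` (cf. p428944); here we record the
operator form's immediate consequence for ALIGNED averages: if `X̄(t) = Ȳ` then `X̄(t) ⪯ I/2`, i.e. `I − 2·X̄(t) ⪰ 0`. -/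
theorem one_sub_two_smul_avg_posSemidef_of_eq {t r : ℕ} {X : OddSet n → Matrix (Fin r) (Fin r) ℝ}
    {Y : PMatch n → Matrix (Fin r) (Fin r) ℝ} (h : IsPsdRect X Y) (hQ : (Qset n t 1).Nonempty)
    (halign : ((1 : ℝ) / (univ.filter (fun U : OddSet n => U.1.card = t)).card) •
              ∑ U ∈ univ.filter (fun U : OddSet n => U.1.card = t), X U =
            ((1 : ℝ) / Fintype.card (PMatch n)) • ∑ M, Y M) :
    (1 - (2 : ℝ) • (((1 : ℝ) / Fintype.card (PMatch n)) • ∑ M, Y M)).PosSemidef := by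
  have h2 := one_sub_avg_add_avg_posSemidef (t := t) h hQ
  rw [halign, ← two_smul ℝ] at h2
  exact h2

end Summit.PneNP.PneNP.Theorems.ChebyshevTracialDesignTightOperator

end
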